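import Summits.HodgeConjecture.HodgeConjecture.Theorems.R90S9DefiniteAeRigidityCutEngine    -- ★ p861961 (this seat): the ENGINE `definiteAeRigidityAt_of_parts` at one instance; brings ★ `hRig`'s D6 currency, E1 currency, the ★ Ch. 14 carpet
import Summits.HodgeConjecture.HodgeConjecture.Theorems.R90S9AeStringOfAe                 -- ★ p862011 (this seat): `aeString_of_ae` — the engine's E1-string pin DISCHARGED at anisotropic `H`
import Summits.HodgeConjecture.HodgeConjecture.Theorems.R90S9SgTailOfAeOfXiLocalFamily     -- (this seat): `sgTail_of_ae_of_xiLocalFamily` — the engine's read-back pin's CONTENT, Γ-free (unique `ξ` + local packets + signed `πˢ`)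
import HarnessLib

/-!
# R90-TF · S9 «InnerForm-13.3.6 (c)» — (AE-ⅱ) «E.V.P. ⟹ Π′(ξ)-MEMBERSHIP for the definite inner form»: THE JUNCTION CUT, HEAD `definiteAeRigidity_of_parts : ‹parts› → (AE-ⅱ)`
# (Rogawski 1990, §14.5 Thm. 14.5.1 (b) p. 238; §14.6 Thm. 14.6.1 p. 241, (14.6.2) p. 242, Thm. 14.6.4 p. 244; §13.3 Thm. 13.3.5 p. 202)

Cell `hodgecm-mathlib`, crux H413 (`stmt-HodgeConjecture-24833`, lane `--supports … --as helper`), route of record `HCCMUnconditional` (no route verbs; count-neutral).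
Programme R90-TF (brief `director/R90-BRIEF.v2.md` 1f40d54518340a35), section S9 = InnerForm-13.3.6 (c) (base `R90-IF`); seat R90-IF-p06 (g0); DEALT BY NAME by R90-IF-plan (g0)
«EMIT S9 WAVE 2» (R90 bus 2026-09-04T16:13:37Z): **p06 → (AE-ⅱ) JUNCTION CUT `Theorems/R90S9DefiniteAeRigidityCut.lean`** (p04 pattern).  THEOREMS ONLY (no `def`, no instance, no
notation, no named fact, no `sorry`); imports ★ `Theorems` only (LAW L9 (β): FILE B `Cruxes/H413/Lines/R90_S9_InnerFormTransportB.lean` may import THIS file at ED. 4).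
HONEST LABEL: HC_CM is proved only modulo the 7 printed citations (2 remaining named inputs: hLiu418 = stmt-HodgeConjecture-24832, h413 = stmt-HodgeConjecture-24833) — until
rung 0 closes.  This file proves NOTHING printed about the §14.6 comparison: it certifies, in the kernel, that the (AE-ⅱ) organ of (B4) — the `hRig` binder of ★
`definiteXiMembership_of_ch14` (p861479), i.e. FILE B ED. 3's `SocketDefiniteAeRigidity` — FOLLOWS from the ∀-closure of the §14.6 PARTS of the engine ★
`definiteAeRigidityAt_of_parts` (p861961): per instance a §14.6 datum `Γ : Ch14Sec6.GlobalData` of `G′ = U(H)` with (S6) Thm. 14.5.1 (b) BY NAME-SHAPE `Γ.thm1451b`, (S5 ∕ S8)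
the ★ `GlobalPacketData` discrete expansions + vanishing classes, (S7) `Γ.thm1461 → Γ.sec146_evp ∧ Γ.sec146_partition ∧ Γ.thm1464a` and `Γ.DSplit`, and DATUM-LEVEL PINS ONLY
(`P ↦ π′` occurs discretely; `Π(ξ) ↦` an A-packet; E1 string ⟹ `Γ.evpRep`; membership in `Π′(ξ′)` READ BACK as «`P`'s finite constituents lie in a ξ₁-local family ★ `IsXiLocalFamily`
with SIGNED second members» — definitional at R90-IF-p01's `InnerFormSec146Data` datum).  The two CONTENT pins of the engine are DISCHARGED by this seat's ★ lemmas: «(AE) ⟹ E1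
string» = ★ `aeString_of_ae` (p862011) and «(AE) + ξ₁-local family with signed second members ⟹ (S-G) tail» = `sgTail_of_ae_of_xiLocalFamily` (Thm. 14.6.4's UNIQUE `ξ` via ★
`R90.S5.xi_eq_of_routesAt_of_memXiFamily_of_not_mem`, `Π′(ξ_v) = {πⁿ, πˢ}(ξ_v) ∘ e` via ★ `KeysCaseTwoLabels` + ★ `comap_cmDatumLocalCongr_symm_eq`, `πˢ ∘ e` = the signed witness).
Kernel leaves by name UNCHANGED: (AE-ⅱ) ↦ {(S6) 14.5.1 (b) at the datum, (S5∕S8) expansions, (S7) §14.6 laws, datum pins} ONCE FILE B sockets them over the CONCRETE datum of record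
(C5 — typ2's pen; (J1)∕LEAD #3 F-π and R90-IF-audit1's SOCKET PRE-AUDIT 16:32:04Z: never a `∀ Γ` ∕ `∃ Γ` socket — the `hParts` TYPE below is a THEOREM hypothesis, (J2), NOT a socket
text); until then (AE-ⅱ) stays ONE socket and this head is its certified pay-line shape.  HONEST FLAGS: (ⅰ) `∃ Γ …` bundle per instance — junk-inhabitable as a bare Prop, meaningful
only at the concrete datum; (ⅱ) (AE-ⅱ) is print's rigidity theorem for the definite inner form, GLOBAL, trace-formula class — nothing here shortens that.
Proof: `intro` the `hRig` prefix, destructure the bundle, apply the engine with `hstring := aeString_of_ae …` and `hback :=` the read pin ∘ `sgTail_of_ae_of_xiLocalFamily`.  Axioms TRIO.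

[cite: Rogawski1990, §14.5 Thm. 14.5.1 (b) p. 238; §14.6 Thm. 14.6.1 (14.6.1) p. 241, p. 242, Thm. 14.6.4 p. 244; §13.3 Thm. 13.3.5 p. 202, p. 201; §13.6 Props. 13.6.1–13.6.2 pp. 208–210; §13.1 Prop. 13.1.3 (d), Prop. 13.1.4 p. 199; §12.2 (2) p. 174]
[cite: FlathCorvallis1979, Thm. 3]
-/

set_option autoImplicit false
-- the mandated namespace repeats `HodgeConjecture.HodgeConjecture`, as in every `Theorems/*.lean` of this sub-problem
set_option linter.dupNamespace false

noncomputable section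

open NumberField IsDedekindDomain MeasureTheory
open scoped Matrix ComplexOrder

open Literature.NumberTheory Literature.NumberTheory.Automorphic Literature.NumberTheory.Automorphic.UnitaryGroup
open Literature.NumberTheory.Automorphic.IdeleClassGroup
open Literature.NumberTheory.GaloisRepresentations
open Literature.NumberTheory.Rogawski1990

namespace Summit.HodgeConjecture.HodgeConjecture.R90.S9

open Summit.HodgeConjecture.HodgeConjecture.Cruxes.H413.F0P3ClassTokenChoice (clFinChoice)
open Summit.HodgeConjecture.HodgeConjecture.Cruxes.H413.F0P3XiLocalFamilyOfRecord (xiFamilyOfRecord)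
open Summit.HodgeConjecture.HodgeConjecture.Cruxes.H413.K2E1EvpOfAutomorphicClass (evpAtIntegralLevel)

open scoped Classical in
set_option synthInstance.maxHeartbeats 400000 in
set_option maxHeartbeats 8000000 in
/-- **HEAD OF THE (AE-ⅱ) CUT `definiteAeRigidity_of_parts : ‹§14.6 parts, ∀-closed› → (AE-ⅱ)`.**  Hypothesis `hParts`: under the FULL `hRig` prefix of ★ `definiteXiMembership_of_ch14`
(`L H hH hHd`, the guards `hanis` «`G′` anisotropic» and `hS₀` «`±H^τ ≻ 0` for some `τ`» [Ch. 14 p. 231; §14.5 p. 237], frames, `Δ mH mG νG νH`, `μω hμu hμω hΔ hcan`, the SIGNED package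
`hQS`, `hex`, `ξ μA P`) there EXIST a §14.6 datum `Γ : Ch14Sec6.GlobalData` of `U(H)` with transfers `Transfer ∕ TransferH`, stable distributions `SθG ∕ SθH`, vanishing classes and an
`H`-matching, readings `π′` of `P` and `Pξ` of `Π(ξ)`, such that: (S6) `Γ.thm1451b Transfer TransferH SθG SθH` (Thm. 14.5.1 (b) BY NAME-SHAPE); (S5 ∕ S8) the ★ `GlobalPacketData`
expansions `DiscreteMinusEndoscopicExpansionG`, `Thm1338Packetwise`, vanishing `H`-transfers exist, `StableDiscreteExpansionH`, transfers land in the vanishing classes; (S7)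
`Γ.thm1461 … → Γ.sec146_evp ∧ Γ.sec146_partition ∧ Γ.thm1464a`, `Γ.DSplit`; PINS `Γ.m′ π′ ≠ 0`, `Γ.G.IsAPacket Pξ`, «E1 string `t(P) = t(⊗ πⁿ(ξ_v))` (★ `evpAtIntegralLevel`) → `Γ.evpRep π′ Pξ`»,
«`Γ.evp (Γ.PiXi′ ξ′ …) Pξ → Γ.mem′ π′ (Γ.PiXi′ ξ′ …) → ∃ ξ₁ F, ξ₁.IsXiLocalFamily … F ∧ LocalConstituentsIn P F ∧ ‹the second members of F are the hQS ξ₁-witnesses›»` (membership in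
`Π′(ξ′)` read back in D6; definitional at the datum).  Conclusion = the `hRig` binder type of ★ `definiteXiMembership_of_ch14` (= FILE B ED. 3 `SocketDefiniteAeRigidity` body) TOKEN FOR
TOKEN.  Proof: the engine ★ `definiteAeRigidityAt_of_parts` at the instance with `hstring := aeString_of_ae …` (★) and `hback :=` read pin ∘ `sgTail_of_ae_of_xiLocalFamily`.  No
`sorry`; axioms `propext`, `Classical.choice`, `Quot.sound`. [cite: Rogawski1990, §14.5 Thm. 14.5.1 (b) p. 238; §14.6 Thm. 14.6.1 p. 241, (14.6.2) p. 242, Thm. 14.6.4 p. 244; §13.3 Thm. 13.3.5 p. 202; §13.1 Prop. 13.1.3 (d), 13.1.4 p. 199] [cite: FlathCorvallis1979, Thm. 3] -/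
theorem definiteAeRigidity_of_parts
    (hParts :
      ∀ (L : Type) [Field L] [NumberField L] [IsCMField L] (H : Matrix (Fin 3) (Fin 3) L)
        (hH : (H.map (cmConjRingHom L))ᵀ = H) (hHd : IsUnit H.det),
        (∀ x : Fin 3 → L, Literature.AlgebraicGeometry.ShimuraVarieties.hermForm (cmConjRingHom L) H x x = 0 → x = 0) →
          (∃ τ : L →+* ℂ, (H.map τ).PosDef ∨ (-(H.map τ)).PosDef) →
      ∀ [∀ v : HeightOneSpectrum (𝓞 ↥(maximalRealSubfield L)), MeasurableSpace ((cmDatum L 3 H).Local v)]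
        [∀ v : HeightOneSpectrum (𝓞 ↥(maximalRealSubfield L)),
          MeasurableSpace ((cmDatum L 2 (Matrix.of fun i j : Fin 2 => if i.val + j.val + 1 = 2 then (1 : L) else 0)).Local v ×
            (cmDatum L 1 (Matrix.of fun i j : Fin 1 => if i.val + j.val + 1 = 1 then (1 : L) else 0)).Local v)]
        [∀ (v : HeightOneSpectrum (𝓞 ↥(maximalRealSubfield L)))
            (a : ((cmDatum L 2 (Matrix.of fun i j : Fin 2 => if i.val + j.val + 1 = 2 then (1 : L) else 0)).Local v ×
              (cmDatum L 1 (Matrix.of fun i j : Fin 1 => if i.val + j.val + 1 = 1 then (1 : L) else 0)).Local v)),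
          MeasurableSpace (((cmDatum L 2 (Matrix.of fun i j : Fin 2 => if i.val + j.val + 1 = 2 then (1 : L) else 0)).Local v ×
              (cmDatum L 1 (Matrix.of fun i j : Fin 1 => if i.val + j.val + 1 = 1 then (1 : L) else 0)).Local v) ⧸
            Subgroup.centralizer ({a} : Set ((cmDatum L 2 (Matrix.of fun i j : Fin 2 => if i.val + j.val + 1 = 2 then (1 : L) else 0)).Local v ×
              (cmDatum L 1 (Matrix.of fun i j : Fin 1 => if i.val + j.val + 1 = 1 then (1 : L) else 0)).Local v)))]
        [∀ (v : HeightOneSpectrum (𝓞 ↥(maximalRealSubfield L))) (γ : (cmDatum L 3 H).Local v),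
          MeasurableSpace ((cmDatum L 3 H).Local v ⧸ Subgroup.centralizer ({γ} : Set ((cmDatum L 3 H).Local v)))]
        (Δ : ∀ v : HeightOneSpectrum (𝓞 ↥(maximalRealSubfield L)), LocalTransferFactor L H v)
        (mH : ∀ v : HeightOneSpectrum (𝓞 ↥(maximalRealSubfield L)),
          OrbitalMeasureFamily ((cmDatum L 2 (Matrix.of fun i j : Fin 2 => if i.val + j.val + 1 = 2 then (1 : L) else 0)).Local v ×
            (cmDatum L 1 (Matrix.of fun i j : Fin 1 => if i.val + j.val + 1 = 1 then (1 : L) else 0)).Local v))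
        (mG : ∀ v : HeightOneSpectrum (𝓞 ↥(maximalRealSubfield L)), OrbitalMeasureFamily ((cmDatum L 3 H).Local v))
        (νG : ∀ v : HeightOneSpectrum (𝓞 ↥(maximalRealSubfield L)), Measure ((cmDatum L 3 H).Local v))
        (νH : ∀ v : HeightOneSpectrum (𝓞 ↥(maximalRealSubfield L)),
          Measure ((cmDatum L 2 (Matrix.of fun i j : Fin 2 => if i.val + j.val + 1 = 2 then (1 : L) else 0)).Local v ×
            (cmDatum L 1 (Matrix.of fun i j : Fin 1 => if i.val + j.val + 1 = 1 then (1 : L) else 0)).Local v))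
        [∀ v : HeightOneSpectrum (𝓞 ↥(maximalRealSubfield L)), BorelSpace ((cmDatum L 3 H).Local v)]
        [∀ v : HeightOneSpectrum (𝓞 ↥(maximalRealSubfield L)),
          BorelSpace ((cmDatum L 2 (Matrix.of fun i j : Fin 2 => if i.val + j.val + 1 = 2 then (1 : L) else 0)).Local v ×
            (cmDatum L 1 (Matrix.of fun i j : Fin 1 => if i.val + j.val + 1 = 1 then (1 : L) else 0)).Local v)]
        [∀ (v : HeightOneSpectrum (𝓞 ↥(maximalRealSubfield L)))
            (a : ((cmDatum L 2 (Matrix.of fun i j : Fin 2 => if i.val + j.val + 1 = 2 then (1 : L) else 0)).Local v ×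
              (cmDatum L 1 (Matrix.of fun i j : Fin 1 => if i.val + j.val + 1 = 1 then (1 : L) else 0)).Local v)),
          BorelSpace (((cmDatum L 2 (Matrix.of fun i j : Fin 2 => if i.val + j.val + 1 = 2 then (1 : L) else 0)).Local v ×
              (cmDatum L 1 (Matrix.of fun i j : Fin 1 => if i.val + j.val + 1 = 1 then (1 : L) else 0)).Local v) ⧸
            Subgroup.centralizer ({a} : Set ((cmDatum L 2 (Matrix.of fun i j : Fin 2 => if i.val + j.val + 1 = 2 then (1 : L) else 0)).Local v ×
              (cmDatum L 1 (Matrix.of fun i j : Fin 1 => if i.val + j.val + 1 = 1 then (1 : L) else 0)).Local v)))]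
        [∀ (v : HeightOneSpectrum (𝓞 ↥(maximalRealSubfield L))) (γ : (cmDatum L 3 H).Local v),
          BorelSpace ((cmDatum L 3 H).Local v ⧸ Subgroup.centralizer ({γ} : Set ((cmDatum L 3 H).Local v)))]
        [∀ v, (νG v).IsHaarMeasure] [∀ v, (νG v).IsMulRightInvariant] [∀ v, (νH v).IsHaarMeasure] [∀ v, (νH v).IsMulRightInvariant],
        ∀ (μω : HeckeCharacter L) (hμu : μω.IsUnitary),
        (∀ x : Literature.NumberTheory.GaloisRepresentations.ideleGroup ↥(maximalRealSubfield L),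
          μω (AdeleRing.ideleBaseChange (↥(maximalRealSubfield L)) L x) = quadraticHeckeCharCM L x) →
        Δ = finExplicitCollection L H μω (finExplicitDelta_conj_left_all L H μω) (finExplicitDelta_conj_right_all L H μω) →
        (∀ v : HeightOneSpectrum (𝓞 ↥(maximalRealSubfield L)), (mH v).IsCanonical (IsLocalGRegular L v) (νH v) ∧
          (mG v).IsCanonical (fun γ => IsRegularElt (γ.val : GL (Fin 3) (UnitaryGroup.LocalRing L v))) (νG v)) →
        ∀ (hQS : CMCharIdentityPackageTestSigned L H hH hHd νH νG μω hμu Δ mH mG),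
        (∀ v : HeightOneSpectrum (𝓞 ↥(maximalRealSubfield L)), (∀ w : PlacesOver L v, IsCMField.complexConj L • w.1 = w.1) →
          IsLocalDeltaTransferExists L H v (Δ v) (mH v) (mG v) Literature.NumberTheory.Rogawski1990.IsLocSmooth
            Literature.NumberTheory.Rogawski1990.IsLocSmooth) →
        ∀ (ξ : OneDimAutRepH L)
          (μA : Measure (adelicGroupData (↥(maximalRealSubfield L)) L (IsCMField.complexConj L) 3 H).automorphicQuotient)
          [(adelicGroupData (↥(maximalRealSubfield L)) L (IsCMField.complexConj L) 3 H).IsAutomorphicMeasure μA]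
          (P : DiscreteAutomorphicRep (adelicGroupData (↥(maximalRealSubfield L)) L (IsCMField.complexConj L) 3 H) μA),
        ∃ (Γ : Ch14Sec6.GlobalData.{0} (CompactlySupportedContinuousMap (cmDatum L 3 H).Adelic ℂ)
            (CompactlySupportedContinuousMap (cmDatum L 3 (Matrix.of fun i j : Fin 3 => if i.val + j.val + 1 = 3 then (1 : L) else 0)).Adelic ℂ)
            (CompactlySupportedContinuousMap ((cmDatum L 2 (Matrix.of fun i j : Fin 2 => if i.val + j.val + 1 = 2 then (1 : L) else 0)).Adelic × (cmDatum L 1 (Matrix.of fun i j : Fin 1 => if i.val + j.val + 1 = 1 then (1 : L) else 0)).Adelic) ℂ))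
          (Transfer : (CompactlySupportedContinuousMap (cmDatum L 3 H).Adelic ℂ) →
            (CompactlySupportedContinuousMap (cmDatum L 3 (Matrix.of fun i j : Fin 3 => if i.val + j.val + 1 = 3 then (1 : L) else 0)).Adelic ℂ) → Prop)
          (TransferH : (CompactlySupportedContinuousMap (cmDatum L 3 H).Adelic ℂ) →
            (CompactlySupportedContinuousMap ((cmDatum L 2 (Matrix.of fun i j : Fin 2 => if i.val + j.val + 1 = 2 then (1 : L) else 0)).Adelic × (cmDatum L 1 (Matrix.of fun i j : Fin 1 => if i.val + j.val + 1 = 1 then (1 : L) else 0)).Adelic) ℂ) → Prop)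
          (SθG : (CompactlySupportedContinuousMap (cmDatum L 3 (Matrix.of fun i j : Fin 3 => if i.val + j.val + 1 = 3 then (1 : L) else 0)).Adelic ℂ) → ℂ)
          (SθH : (CompactlySupportedContinuousMap ((cmDatum L 2 (Matrix.of fun i j : Fin 2 => if i.val + j.val + 1 = 2 then (1 : L) else 0)).Adelic × (cmDatum L 1 (Matrix.of fun i j : Fin 1 => if i.val + j.val + 1 = 1 then (1 : L) else 0)).Adelic) ℂ) → ℂ)
          (PSVanish : (CompactlySupportedContinuousMap (cmDatum L 3 (Matrix.of fun i j : Fin 3 => if i.val + j.val + 1 = 3 then (1 : L) else 0)).Adelic ℂ) → Prop)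
          (PSVanishH : (CompactlySupportedContinuousMap ((cmDatum L 2 (Matrix.of fun i j : Fin 2 => if i.val + j.val + 1 = 2 then (1 : L) else 0)).Adelic × (cmDatum L 1 (Matrix.of fun i j : Fin 1 => if i.val + j.val + 1 = 1 then (1 : L) else 0)).Adelic) ℂ) → Prop)
          (MatchH : (CompactlySupportedContinuousMap (cmDatum L 3 (Matrix.of fun i j : Fin 3 => if i.val + j.val + 1 = 3 then (1 : L) else 0)).Adelic ℂ) →
            (CompactlySupportedContinuousMap ((cmDatum L 2 (Matrix.of fun i j : Fin 2 => if i.val + j.val + 1 = 2 then (1 : L) else 0)).Adelic × (cmDatum L 1 (Matrix.of fun i j : Fin 1 => if i.val + j.val + 1 = 1 then (1 : L) else 0)).Adelic) ℂ) → Prop)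
          (π' : Γ.Rep') (Pξ : Γ.G.Packet),
          -- (S6) Thm. 14.5.1 (b) BY NAME-SHAPE
          Γ.thm1451b Transfer TransferH SθG SθH ∧
          -- (S5 ∕ S8) discrete expansions + vanishing classes (the hypotheses of ★ `Ch14Bridge.thm1461_of_thm1451b_of_prop1362`)
          Γ.G.DiscreteMinusEndoscopicExpansionG Γ.tr Γ.trH SθG PSVanish PSVanishH MatchH ∧
          Γ.G.Thm1338Packetwise Γ.tr Γ.trH MatchH ∧
          (∀ f, PSVanish f → ∃ fH, PSVanishH fH ∧ MatchH f fH) ∧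
          Γ.G.StableDiscreteExpansionH Γ.trH SθH PSVanishH ∧
          (∀ f' f, Transfer f' f → PSVanish f) ∧ (∀ f' fH, TransferH f' fH → PSVanishH fH) ∧
          -- (S7) (14.6.1) ⟹ §14.6 for `D = M₃(E)`
          (Γ.thm1461 Transfer TransferH → Γ.sec146_evp ∧ Γ.sec146_partition ∧ Γ.thm1464a) ∧ Γ.DSplit ∧
          -- PINS at the datum: `P` occurs discretely; `Π(ξ) ∈ Π_a(G)`; the E1 string ⟹ `evpRep`; membership in `Π′(ξ′)` READ BACK as a ξ₁-local family with SIGNED second members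
          Γ.m' π' ≠ 0 ∧ Γ.G.IsAPacket Pξ ∧
          ((∃ S₀ : Finset (HeightOneSpectrum (𝓞 ↥(maximalRealSubfield L))),
             ∀ (S : Set (HeightOneSpectrum (𝓞 ↥(maximalRealSubfield L)))), (↑S₀ : Set _) ⊆ S →
               ∀ (hP : ∀ v, v ∉ S → (clFinChoice P v).IsSpherical (cmLocalIntegralLevel L 3 H v))
                 (hξ : ∀ v, v ∉ S → (xiFamilyOfRecord L H hH hHd μω hμu ξ v).πn.IsSpherical (cmLocalIntegralLevel L 3 H v)),
                 evpAtIntegralLevel L 3 H (fun v => clFinChoice P v) S hP =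
                   evpAtIntegralLevel L 3 H (fun v => (xiFamilyOfRecord L H hH hHd μω hμu ξ v).πn) S hξ) →
            Γ.evpRep π' Pξ) ∧
          (∀ (ξ' : Γ.G.PacketH) (h₁ : Γ.IsOneDimH ξ') (hS : ∀ v, v ∈ Γ.S₀ → Γ.MnNeZero ξ' v),
            Γ.evp (Γ.PiXi' ξ' h₁ hS) Pξ → Γ.mem' π' (Γ.PiXi' ξ' h₁ hS) →
            ∃ (ξ₁ : OneDimAutRepH L) (F : ∀ v : HeightOneSpectrum (𝓞 ↥(maximalRealSubfield L)), CMLocalAPacket L H v),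
              ξ₁.IsXiLocalFamily hH hHd μω hμu F ∧ LocalConstituentsIn P F ∧
              ∀ (v : HeightOneSpectrum (𝓞 ↥(maximalRealSubfield L))) (hns : ∀ w : PlacesOver L v, IsCMField.complexConj L • w.1 = w.1)
                (T : GL (Fin 3) (LocalRing L v)) (a : LocalRing L v) (ha : IsUnit a)
                (h : formCongr (conjLocal L (IsCMField.complexConj L) v) T (H.map (algebraMap L (LocalRing L v))) =
                  a • (Matrix.of fun i j : Fin 3 => if i.val + j.val + 1 = 3 then (1 : L) else 0).map (algebraMap L (LocalRing L v))),
                ∀ [MeasurableSpace (Gqs L v ⧸ Subgroup.center (Gqs L v))] [BorelSpace (Gqs L v ⧸ Subgroup.center (Gqs L v))]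
                  (μZ : Measure (Gqs L v ⧸ Subgroup.center (Gqs L v))) [μZ.IsHaarMeasure],
                ∀ (π2 πn : IrrClass (Gqs L v))
                  (hK : KeysCaseTwoLabels L v (μω.semilocalComponent L v) (torusLocalComponent L (IsCMField.complexConj L) v ξ₁.η)
                    (torusLocalComponent L (IsCMField.complexConj L) v ξ₁.ψ) π2 πn)
                  (hn : ¬ πn.IsSquareIntegrable μZ) (c : IrrClass ((cmDatum L 3 H).Local v)),
                  (F v).πs = some c → c = ((hQS ξ₁).1 v hns T a ha h μZ π2 πn hK hn).πs)) :
    ∀ (L : Type) [Field L] [NumberField L] [IsCMField L] (H : Matrix (Fin 3) (Fin 3) L)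
      (hH : (H.map (cmConjRingHom L))ᵀ = H) (hHd : IsUnit H.det),
      (∀ x : Fin 3 → L, Literature.AlgebraicGeometry.ShimuraVarieties.hermForm (cmConjRingHom L) H x x = 0 → x = 0) →
        (∃ τ : L →+* ℂ, (H.map τ).PosDef ∨ (-(H.map τ)).PosDef) →
    ∀ [∀ v : HeightOneSpectrum (𝓞 ↥(maximalRealSubfield L)), MeasurableSpace ((cmDatum L 3 H).Local v)]
      [∀ v : HeightOneSpectrum (𝓞 ↥(maximalRealSubfield L)),
        MeasurableSpace ((cmDatum L 2 (Matrix.of fun i j : Fin 2 => if i.val + j.val + 1 = 2 then (1 : L) else 0)).Local v ×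
          (cmDatum L 1 (Matrix.of fun i j : Fin 1 => if i.val + j.val + 1 = 1 then (1 : L) else 0)).Local v)]
      [∀ (v : HeightOneSpectrum (𝓞 ↥(maximalRealSubfield L)))
          (a : ((cmDatum L 2 (Matrix.of fun i j : Fin 2 => if i.val + j.val + 1 = 2 then (1 : L) else 0)).Local v ×
            (cmDatum L 1 (Matrix.of fun i j : Fin 1 => if i.val + j.val + 1 = 1 then (1 : L) else 0)).Local v)),
        MeasurableSpace (((cmDatum L 2 (Matrix.of fun i j : Fin 2 => if i.val + j.val + 1 = 2 then (1 : L) else 0)).Local v ×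
            (cmDatum L 1 (Matrix.of fun i j : Fin 1 => if i.val + j.val + 1 = 1 then (1 : L) else 0)).Local v) ⧸
          Subgroup.centralizer ({a} : Set ((cmDatum L 2 (Matrix.of fun i j : Fin 2 => if i.val + j.val + 1 = 2 then (1 : L) else 0)).Local v ×
            (cmDatum L 1 (Matrix.of fun i j : Fin 1 => if i.val + j.val + 1 = 1 then (1 : L) else 0)).Local v)))]
      [∀ (v : HeightOneSpectrum (𝓞 ↥(maximalRealSubfield L))) (γ : (cmDatum L 3 H).Local v),
        MeasurableSpace ((cmDatum L 3 H).Local v ⧸ Subgroup.centralizer ({γ} : Set ((cmDatum L 3 H).Local v)))]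
      (Δ : ∀ v : HeightOneSpectrum (𝓞 ↥(maximalRealSubfield L)), LocalTransferFactor L H v)
      (mH : ∀ v : HeightOneSpectrum (𝓞 ↥(maximalRealSubfield L)),
        OrbitalMeasureFamily ((cmDatum L 2 (Matrix.of fun i j : Fin 2 => if i.val + j.val + 1 = 2 then (1 : L) else 0)).Local v ×
          (cmDatum L 1 (Matrix.of fun i j : Fin 1 => if i.val + j.val + 1 = 1 then (1 : L) else 0)).Local v))
      (mG : ∀ v : HeightOneSpectrum (𝓞 ↥(maximalRealSubfield L)), OrbitalMeasureFamily ((cmDatum L 3 H).Local v))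
      (νG : ∀ v : HeightOneSpectrum (𝓞 ↥(maximalRealSubfield L)), Measure ((cmDatum L 3 H).Local v))
      (νH : ∀ v : HeightOneSpectrum (𝓞 ↥(maximalRealSubfield L)),
        Measure ((cmDatum L 2 (Matrix.of fun i j : Fin 2 => if i.val + j.val + 1 = 2 then (1 : L) else 0)).Local v ×
          (cmDatum L 1 (Matrix.of fun i j : Fin 1 => if i.val + j.val + 1 = 1 then (1 : L) else 0)).Local v))
      [∀ v : HeightOneSpectrum (𝓞 ↥(maximalRealSubfield L)), BorelSpace ((cmDatum L 3 H).Local v)]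
      [∀ v : HeightOneSpectrum (𝓞 ↥(maximalRealSubfield L)),
        BorelSpace ((cmDatum L 2 (Matrix.of fun i j : Fin 2 => if i.val + j.val + 1 = 2 then (1 : L) else 0)).Local v ×
          (cmDatum L 1 (Matrix.of fun i j : Fin 1 => if i.val + j.val + 1 = 1 then (1 : L) else 0)).Local v)]
      [∀ (v : HeightOneSpectrum (𝓞 ↥(maximalRealSubfield L)))
          (a : ((cmDatum L 2 (Matrix.of fun i j : Fin 2 => if i.val + j.val + 1 = 2 then (1 : L) else 0)).Local v ×
            (cmDatum L 1 (Matrix.of fun i j : Fin 1 => if i.val + j.val + 1 = 1 then (1 : L) else 0)).Local v)),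
        BorelSpace (((cmDatum L 2 (Matrix.of fun i j : Fin 2 => if i.val + j.val + 1 = 2 then (1 : L) else 0)).Local v ×
            (cmDatum L 1 (Matrix.of fun i j : Fin 1 => if i.val + j.val + 1 = 1 then (1 : L) else 0)).Local v) ⧸
          Subgroup.centralizer ({a} : Set ((cmDatum L 2 (Matrix.of fun i j : Fin 2 => if i.val + j.val + 1 = 2 then (1 : L) else 0)).Local v ×
            (cmDatum L 1 (Matrix.of fun i j : Fin 1 => if i.val + j.val + 1 = 1 then (1 : L) else 0)).Local v)))]
      [∀ (v : HeightOneSpectrum (𝓞 ↥(maximalRealSubfield L))) (γ : (cmDatum L 3 H).Local v),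
        BorelSpace ((cmDatum L 3 H).Local v ⧸ Subgroup.centralizer ({γ} : Set ((cmDatum L 3 H).Local v)))]
      [∀ v, (νG v).IsHaarMeasure] [∀ v, (νG v).IsMulRightInvariant] [∀ v, (νH v).IsHaarMeasure] [∀ v, (νH v).IsMulRightInvariant],
      ∀ (μω : HeckeCharacter L) (hμu : μω.IsUnitary),
      (∀ x : Literature.NumberTheory.GaloisRepresentations.ideleGroup ↥(maximalRealSubfield L),
        μω (AdeleRing.ideleBaseChange (↥(maximalRealSubfield L)) L x) = quadraticHeckeCharCM L x) →
      Δ = finExplicitCollection L H μω (finExplicitDelta_conj_left_all L H μω) (finExplicitDelta_conj_right_all L H μω) →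
      (∀ v : HeightOneSpectrum (𝓞 ↥(maximalRealSubfield L)), (mH v).IsCanonical (IsLocalGRegular L v) (νH v) ∧
        (mG v).IsCanonical (fun γ => IsRegularElt (γ.val : GL (Fin 3) (UnitaryGroup.LocalRing L v))) (νG v)) →
      ∀ (hQS : CMCharIdentityPackageTestSigned L H hH hHd νH νG μω hμu Δ mH mG),
      (∀ v : HeightOneSpectrum (𝓞 ↥(maximalRealSubfield L)), (∀ w : PlacesOver L v, IsCMField.complexConj L • w.1 = w.1) →
        IsLocalDeltaTransferExists L H v (Δ v) (mH v) (mG v) Literature.NumberTheory.Rogawski1990.IsLocSmooth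
          Literature.NumberTheory.Rogawski1990.IsLocSmooth) →
      ∀ (ξ : OneDimAutRepH L)
        (μA : Measure (adelicGroupData (↥(maximalRealSubfield L)) L (IsCMField.complexConj L) 3 H).automorphicQuotient)
        [(adelicGroupData (↥(maximalRealSubfield L)) L (IsCMField.complexConj L) 3 H).IsAutomorphicMeasure μA]
        (P : DiscreteAutomorphicRep (adelicGroupData (↥(maximalRealSubfield L)) L (IsCMField.complexConj L) 3 H) μA),
        -- hypothesis (AE) «t(P) = t(Π(ξ))» — the e.v.p. of P is that of the A-packet Π(ξ) (TEXT = the conclusion of `hAE` BYTE FOR BYTE)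
        (∃ S : Finset (HeightOneSpectrum (𝓞 ↥(maximalRealSubfield L))),
          (∀ v : HeightOneSpectrum (𝓞 ↥(maximalRealSubfield L)), v ∉ S →
            ∀ (hns : ∀ w : PlacesOver L v, IsCMField.complexConj L • w.1 = w.1)
              (T : GL (Fin 3) (LocalRing L v)) (a : LocalRing L v) (ha : IsUnit a)
              (h : formCongr (conjLocal L (IsCMField.complexConj L) v) T (H.map (algebraMap L (LocalRing L v))) =
                a • (Matrix.of fun i j : Fin 3 => if i.val + j.val + 1 = 3 then (1 : L) else 0).map (algebraMap L (LocalRing L v))),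
            ∀ [MeasurableSpace (Gqs L v ⧸ Subgroup.center (Gqs L v))] [BorelSpace (Gqs L v ⧸ Subgroup.center (Gqs L v))]
              (μZ : Measure (Gqs L v ⧸ Subgroup.center (Gqs L v))) [μZ.IsHaarMeasure],
            ∀ (π2 πn : IrrClass (Gqs L v)),
              KeysCaseTwoLabels L v (μω.semilocalComponent L v) (torusLocalComponent L (IsCMField.complexConj L) v ξ.η)
                (torusLocalComponent L (IsCMField.complexConj L) v ξ.ψ) π2 πn →
              ¬ πn.IsSquareIntegrable μZ →
              ∀ c : IrrClass ((cmDatum L 3 H).Local v),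
                (IrrClass.comap (localPiEquiv L (IsCMField.complexConj L) 3 H v) c).IsConstituentOf
                    (P.finRep.smoothPart.toRepresentation.comp (inclPlace (↥(maximalRealSubfield L)) L (IsCMField.complexConj L) 3 H v)) →
                c = IrrClass.comap (cmDatumLocalCongr L v T ha h).symm πn) ∧
          (∀ v : HeightOneSpectrum (𝓞 ↥(maximalRealSubfield L)), v ∉ S →
            ∀ (hs : ∃ w : PlacesOver L v, IsCMField.complexConj L • w.1 ≠ w.1),
              ∀ c : IrrClass ((cmDatum L 3 H).Local v),
                (IrrClass.comap (localPiEquiv L (IsCMField.complexConj L) 3 H v) c).IsConstituentOf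
                    (P.finRep.smoothPart.toRepresentation.comp (inclPlace (↥(maximalRealSubfield L)) L (IsCMField.complexConj L) 3 H v)) →
                c ∈ (cmSplitPacket L H hH hHd v (splitWitness v hs) (splitWitness_spec v hs) (ξ.splitν₀ μω (splitWitness v hs).1)
                  (ξ.locψ (splitWitness v hs).1) (ξ.norm_splitν₀_apply hμu (splitWitness v hs).1)
                  (ξ.continuous_splitν₀ μω (splitWitness v hs).1) (ξ.norm_locψ_apply (splitWitness v hs).1)
                  (ξ.continuous_locψ (splitWitness v hs).1)).members)) →
        ∀ (v : HeightOneSpectrum (𝓞 ↥(maximalRealSubfield L))) (hns : ∀ w : PlacesOver L v, IsCMField.complexConj L • w.1 = w.1),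
        ∀ (T : GL (Fin 3) (LocalRing L v)) (a : LocalRing L v) (ha : IsUnit a)
          (h : formCongr (conjLocal L (IsCMField.complexConj L) v) T (H.map (algebraMap L (LocalRing L v))) =
            a • (Matrix.of fun i j : Fin 3 => if i.val + j.val + 1 = 3 then (1 : L) else 0).map (algebraMap L (LocalRing L v))),
        ∀ [MeasurableSpace (Gqs L v ⧸ Subgroup.center (Gqs L v))] [BorelSpace (Gqs L v ⧸ Subgroup.center (Gqs L v))]
          (μZ : Measure (Gqs L v ⧸ Subgroup.center (Gqs L v))) [μZ.IsHaarMeasure],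
        ∀ (π2 πn : IrrClass (Gqs L v)),
        ∀ (hK : KeysCaseTwoLabels L v (μω.semilocalComponent L v) (torusLocalComponent L (IsCMField.complexConj L) v ξ.η)
            (torusLocalComponent L (IsCMField.complexConj L) v ξ.ψ) π2 πn)
          (hn : ¬ πn.IsSquareIntegrable μZ),
          -- (S-G) «13.3.6 (c) ∕ §14.6 AT PRINT'S PINNED DATA»: every v-constituent of P is πⁿ ∘ e, π² ∘ e, or the πˢ(ξ_v) ∘ e of `hQS`
          ∀ c : IrrClass ((cmDatum L 3 H).Local v),
            (IrrClass.comap (localPiEquiv L (IsCMField.complexConj L) 3 H v) c).IsConstituentOf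
                (P.finRep.smoothPart.toRepresentation.comp (inclPlace (↥(maximalRealSubfield L)) L (IsCMField.complexConj L) 3 H v)) →
            c = IrrClass.comap (cmDatumLocalCongr L v T ha h).symm πn ∨
              c = IrrClass.comap (cmDatumLocalCongr L v T ha h).symm π2 ∨
              c = ((hQS ξ).1 v hns T a ha h μZ π2 πn hK hn).πs := by
  intro L _ _ _ H hH hHd hanis hS₀ _ _ _ _ Δ mH mG νG νH _ _ _ _ _ _ _ _ μω hμu hμω hΔ hcan hQS hex ξ μA _ P hAE
  obtain ⟨Γ, Transfer, TransferH, SθG, SθH, PSVanish, PSVanishH, MatchH, π', Pξ, h51, h62, h38, hexH, hH61, hvan, hvanH, h64, hD,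
    hm, hA, hevp, hread⟩ := hParts L H hH hHd hanis hS₀ Δ mH mG νG νH μω hμu hμω hΔ hcan hQS hex ξ μA P
  refine definiteAeRigidityAt_of_parts L H hH hHd Δ mH mG νG νH μω hμu hQS ξ μA P hAE Γ Transfer TransferH SθG SθH h51 PSVanish PSVanishH
    MatchH h62 h38 hexH hH61 hvan hvanH h64 hD π' hm Pξ hA (aeString_of_ae L H hH hHd hanis μω hμu hμω ξ μA P) hevp ?_
  -- the read-back pin: membership in `Π′(ξ′)` read as a ξ₁-local family with signed second members, then `sgTail_of_ae_of_xiLocalFamily`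
  intro ξ' h₁ hS hevp' hmem'
  obtain ⟨ξ₁, F, hF, hFP, hFs⟩ := hread ξ' h₁ hS hevp' hmem'
  exact sgTail_of_ae_of_xiLocalFamily L H hH hHd hanis Δ mH mG νG νH μω hμu hμω hQS ξ μA P hAE ξ₁ F hF hFP hFs

end Summit.HodgeConjecture.HodgeConjecture.R90.S9

end
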